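import Summits.ValiantsHypothesis.ValiantsHypothesis.Theorems.GrenetZeonDualUnipotentThreeHalvesHeavyTopCompositionBound
import Summits.ValiantsHypothesis.ValiantsHypothesis.Theorems.GrenetZeonDualUnipotentThreeHalvesHeavyTopIotaFourReducible

/-!
# `GrenetZeon.DualUnipotentThreeHalves` (stmt-ValiantsHypothesis-24318), R2 `HeavyTopLaw` — instrument kernel row:
# `(4,6)` NOW RESTS ON `ι(5) ≤ 7 ∧ ι(6) ≤ 11` ONLY (the `ι(4) ≤ 3` hypothesis of ✓ `heavyTopInst_four_six_of_iota` DISCHARGED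
# by the kernel theorem `ι(4) = 3`, ✓ `HeavyTopIotaFour.finrank_le_three_of_irreducible`, eng-1 / val-port-3 g2)

* `heavyTopInst_four_six_of_iota56 (hι5) (hι6) : HeavyTopInst 4 6` — ✓ `HeavyTopIotaFour.finrank_le_three_of_irreducible`
  (val-port-3 g2 over eng-1's assembly) IS the `hι4` binder of ✓ `heavyTopInst_four_six_of_iota`, token for token.

HONEST LABEL: still a CONDITIONAL instance row (`ι(5) ≤ 7` — machine-certified by val-htc eng-1, kernel pending — and `ι(6) ≤ 11` — open
— remain hypotheses); nothing here proves `HeavyTopInst 4 6` outright, nor `HeavyTopLaw`, 24318; `VP ≠ VNP` is NOT proved; no summit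
statement is proved here.  No definitions, no named facts.  (INSTANCES.md val-port-3 g2; critic val-idea-crit-3 g4.)
-/

noncomputable section

-- single-conjunct layout: Sub = Summit, duplicated namespace component intended
set_option linter.dupNamespace false

namespace Summit.ValiantsHypothesis.ValiantsHypothesis.Theorems.GrenetZeon.HeavyTopCompositionBound

open Matrix
open Summit.ValiantsHypothesis.ValiantsHypothesis.Theorems.GrenetZeon.RadicalSplit (HeavyTopInst)
open Summit.ValiantsHypothesis.ValiantsHypothesis.Theorems.GrenetZeon.HeavyTopIotaFour (finrank_le_three_of_irreducible)

/-- **`ι(5) ≤ 7 ∧ ι(6) ≤ 11 ⟹ HeavyTopInst 4 6`** — the `(4,6)` row with `ι(4) ≤ 3` discharged in the kernel. -/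
theorem heavyTopInst_four_six_of_iota56
    (hι5 : ∀ V : Submodule ℂ (Matrix (Fin 5) (Fin 5) ℂ), (∀ A ∈ V, IsNilpotent A) →
      (∀ U : Submodule ℂ (Fin 5 → ℂ), (∀ A ∈ V, ∀ x ∈ U, A *ᵥ x ∈ U) → U = ⊥ ∨ U = ⊤) →
      Module.finrank ℂ V ≤ 7)
    (hι6 : ∀ V : Submodule ℂ (Matrix (Fin 6) (Fin 6) ℂ), (∀ A ∈ V, IsNilpotent A) →
      (∀ U : Submodule ℂ (Fin 6 → ℂ), (∀ A ∈ V, ∀ x ∈ U, A *ᵥ x ∈ U) → U = ⊥ ∨ U = ⊤) →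
      Module.finrank ℂ V ≤ 11) :
    HeavyTopInst 4 6 :=
  heavyTopInst_four_six_of_iota finrank_le_three_of_irreducible hι5 hι6

end Summit.ValiantsHypothesis.ValiantsHypothesis.Theorems.GrenetZeon.HeavyTopCompositionBound

end
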